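import Summits.AtomisticToContinuum.Crystallization.Theses.FluxTubeKepler
import Summits.AtomisticToContinuum.Crystallization.Theorems.FluxTubeKeplerFluxCellKeplerPricingConsequences
import Summits.AtomisticToContinuum.Crystallization.Theorems.FluxTubeKeplerFluxCellKeplerEnergyIdentity

/-!
# `FluxCellKepler` (stmt-AtomisticToContinuum-15221) — the BC2 REDIRECT assembly
# `FluxTubeDomination → RealisedCellKepler → FluxCellKepler` (crux-strategist, route re-audit)

The deciding crux `X = FluxTubeKepler.FluxCellKepler` (`∃ P₀ R₁ τ, DOM ∧ KEPLER`) is at least as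
strong as the sub-problem (`crystallization_of_fluxCellKepler`, landed).  Its typed decomposition
(human ruling 2026-08-16, "restated is a redirect") separates the two kinds of mathematics the
single existential `∃ τ` was hiding:

* `X₁ = FluxTubeDomination` — THOMSON'S PRINCIPLE IN `ℝ⁸ = ℝ³ × ℝ⁵` FOR ARBITRARY ADMISSIBLE
  FIELDS, localised to cells: for every smearing radius `a > 0`, every finite `2a`-separated
  configuration `x` of `ℝ³`, every family of pairwise disjoint measurable cells `Ω_i ⊆ ℝ³` and every
  `L²` vector field `G` on `ℝ⁸` vanishing off the tubes `Ω_i × ℝ⁵` whose weak divergence is the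
  total smeared charge `Σ_i ρ_a(· − ι x_i)` (uniform probability on the 8-balls of radius `a`),
  `Σ_i Σ_(j≠i) |x_i − x_j|⁻⁶ ≤ 2π⁴ Σ_i (∫_(Ω_i × ℝ⁵) ‖G‖² − t_a(x_i))`, `t_a` the free smeared
  self-energy (an `sInf`).  Pure 8-D electrostatics (Newton's theorem for the kernel `|y|⁻⁶ =
  2π⁴ Φ₈`, the Dirichlet/Thomson principle, additivity of the integral over disjoint cells); it
  generalises the route's support `FluxTubeBound` (q = 0) to every admissible wall flux and says
  nothing about crystals.
* `X₂ = RealisedCellKepler` — THE REALISED CELL KEPLER INEQUALITY: there are `R₁` and a local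
  credit `τ` (a function of the pattern of relative positions within `R₁`) which is SITEWISE an
  upper bound of the confined cell energy `2π⁴(∫_(Ω_i × ℝ⁵) ‖G‖² − t_a(x_i))` of SOME admissible
  field on SOME disjoint measurable cells (for every finite injective configuration), and whose
  finite-range cell functional `λ_i = (1/24) site₁₂ − τ_i/12` satisfies the Kepler-type inequality
  `Σ_i λ_i ≥ N e⋆ + c(δ,R,η) · #bad_(R,η)` on `δ`-separated configurations, `e⋆ = ⨅_Q e(Q)` the
  periodic infimum (no periodic minimiser `P₀` is posited).  A statement about a cell functional;
  without `X₁` it is not linked to the Lennard-Jones energy at all.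

Assembly (this file, sorry-free): realisation + `X₁` give (DOM) by summation over sites; (DOM), the
energy identity `E = Σ_i ((1/24) site₁₂ − (1/12) site₆)` (`interactionEnergy_lennardJones_eq_sum`,
landed) and KEPLER⋆ give the τ-free defect pricing, whence a periodic minimiser `P₀` with
`e(P₀) = e⋆` (`crysPeriodicMinAttained_of_defectPricing`, landed), and KEPLER⋆ is KEPLER at `P₀`.
The hypotheses are spelled out verbatim (they become the route's leaves `FluxTubeDomination`,
`RealisedCellKepler` by `route edit --split FluxCellKepler`, glued by this theorem).
-/

namespace Summit.AtomisticToContinuum.Crystallization.Theorems.FluxCellKeplerSplit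

open scoped BigOperators
open MeasureTheory Literature.MathematicalPhysics.StatisticalMechanics

/-- **BC2 redirect assembly for `FluxCellKepler`**: flux-tube domination (Thomson's principle in
`ℝ⁸` for arbitrary admissible fields, localised to disjoint measurable cells) and the realised cell
Kepler inequality (a local credit sitewise dominating the confined cell energy of some admissible
field, whose cell functional prices `(R,η)`-non-layered sites linearly above `N e⋆`) imply the
route's deciding crux `FluxTubeKepler.FluxCellKepler` by name.  (DOM) by summation; the periodic
minimiser from the induced τ-free pricing through the landed chain
`crysPeriodicMinAttained_of_defectPricing`. [folklore] -/
theorem FluxCellKepler_of_subs : (let ι : EuclideanSpace ℝ (Fin 3) → EuclideanSpace ℝ (Fin 8) := fun v => (EuclideanSpace.equiv (Fin 8) ℝ).symm (fun k => if h : (k : ℕ) < 3 then v ⟨k, h⟩ else 0); let π : EuclideanSpace ℝ (Fin 8) → EuclideanSpace ℝ (Fin 3) := fun y => (EuclideanSpace.equiv (Fin 3) ℝ).symm (fun k => y (Fin.castLE (by norm_num) k)); let t : ℝ → EuclideanSpace ℝ (Fin 3) → ℝ := fun a x₀ => sInf {e : ℝ | ∃ F : EuclideanSpace ℝ (Fin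 8) → EuclideanSpace ℝ (Fin 8), MemLp F 2 volume ∧ (∀ φ : EuclideanSpace ℝ (Fin 8) → ℝ, ContDiff ℝ 1 φ → HasCompactSupport φ → ∫ y, inner ℝ (F y) (gradient φ y) = -(((volume (Metric.ball (ι x₀) a)).toReal)⁻¹ * ∫ y in Metric.ball (ι x₀) a, φ y)) ∧ e = ∫ y, ‖F y‖ ^ 2}; ∀ a : ℝ, 0 < a → ∀ (N : ℕ) (x : Fin N → EuclideanSpace ℝ (Fin 3)), (∀ i j, i ≠ j → 2 * a < dist (x i) (x j)) → ∀ (Ω : Fin N → Set (EuclideanSpace ℝ (Fin 3))) (G : EuclideanSpace ℝ (Fin 8) → EuclideanSpace ℝ (Fin 8)), (Pairwise fun i j => Disjoint (Ω i) (Ω j)) → (∀ i, MeasurableSet (Ω i)) → MemLp G 2 volume → (∀ y, π y ∉ (⋃ i, Ω i) → G y = 0) → (∀ φ : EuclideanSpace ℝ (Fin 8) → ℝ, ContDiff ℝ 1 φ → HasCompactSupport φ → ∫ y, inner ℝ (G y) (gradient φ y) = -∑ i, ((volume (Metric.ball (ι (x i)) a)).toReal)⁻¹ * ∫ y in Metric.ball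 (ι (x i)) a, φ y) → ∑ i, siteEnergy (fun r => (r⁻¹) ^ 6) x i ≤ 2 * Real.pi ^ 4 * ∑ i, ((∫ y in {y | π y ∈ Ω i}, ‖G y‖ ^ 2) - t a (x i))) → (let ι : EuclideanSpace ℝ (Fin 3) → EuclideanSpace ℝ (Fin 8) := fun v => (EuclideanSpace.equiv (Fin 8) ℝ).symm (fun k => if h : (k : ℕ) < 3 then v ⟨k, h⟩ else 0); let π : EuclideanSpace ℝ (Fin 8) → EuclideanSpace ℝ (Fin 3) := fun y => (EuclideanSpace.equiv (Fin 3) ℝ).symm (fun k => y (Fin.castLE (by norm_num) k)); let t : ℝ → EuclideanSpace ℝ (Fin 3) → ℝ := fun a x₀ => sInf {e : ℝ | ∃ F : EuclideanSpace ℝ (Fin 8) → EuclideanSpace ℝ (Fin 8), MemLp F 2 volume ∧ (∀ φ : EuclideanSpace ℝ (Fin 8) → ℝ, ContDiff ℝ 1 φ → HasCompactSupport φ → ∫ y, inner ℝ (F y) (gradient φ y) = -(((volume (Metric.ball (ι x₀) a)).toReal)⁻¹ * ∫ y in Metric.ball (ι x₀) a, φ y)) ∧ e = ∫ y, ‖F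 y‖ ^ 2}; ∃ (R₁ : ℝ) (τ : Finset (EuclideanSpace ℝ (Fin 3)) → ℝ), (∀ (N : ℕ) (x : Fin N → EuclideanSpace ℝ (Fin 3)), Function.Injective x → ∃ a : ℝ, 0 < a ∧ (∀ i j, i ≠ j → 2 * a < dist (x i) (x j)) ∧ ∃ (Ω : Fin N → Set (EuclideanSpace ℝ (Fin 3))) (G : EuclideanSpace ℝ (Fin 8) → EuclideanSpace ℝ (Fin 8)), (Pairwise fun i j => Disjoint (Ω i) (Ω j)) ∧ (∀ i, MeasurableSet (Ω i)) ∧ MemLp G 2 volume ∧ (∀ y, π y ∉ (⋃ i, Ω i) → G y = 0) ∧ (∀ φ : EuclideanSpace ℝ (Fin 8) → ℝ, ContDiff ℝ 1 φ → HasCompactSupport φ → ∫ y, inner ℝ (G y) (gradient φ y) = -∑ i, ((volume (Metric.ball (ι (x i)) a)).toReal)⁻¹ * ∫ y in Metric.ball (ι (x i)) a, φ y) ∧ ∀ i, 2 * Real.pi ^ 4 * ((∫ y in {y | π y ∈ Ω i}, ‖G y‖ ^ 2) - t a (x i)) ≤ τ ((Finset.univ.filter fun j : Fin N => dist (x j)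 (x i) ≤ R₁).image fun j => x j - x i)) ∧ (∀ δ : ℝ, 0 < δ → ∀ R η : ℝ, 0 < R → 0 < η → ∃ c : ℝ, 0 < c ∧ ∀ (N : ℕ) (x : Fin N → EuclideanSpace ℝ (Fin 3)), Function.Injective x → (∀ i j, i ≠ j → δ ≤ dist (x i) (x j)) → c * (Nat.card {i : Fin N // ¬ ∃ a : ℝ, 47 / 50 ≤ a ∧ a ≤ 1 ∧ ∃ (A : EuclideanSpace ℝ (Fin 3) →ₗᵢ[ℝ] EuclideanSpace ℝ (Fin 3)) (s : ℤ → ℤ) (z : ℤ → ℝ), IsHaggSeq s ∧ (∀ m : ℤ, 39 / 50 * a ≤ z (m + 1) - z m ∧ z (m + 1) - z m ≤ 17 / 20 * a) ∧ let S : Set (EuclideanSpace ℝ (Fin 3)) := {p | ∃ m k l : ℤ, p = A (((k : ℝ) • triangularVec₁ a) + ((l : ℝ) • triangularVec₂ a) + ((haggLabel s m : ℝ) • barlowOffset a) + (z m • layerNormal 1))}; (∀ p ∈ S, ‖p‖ ≤ R → ∃ j : Fin N, dist (x j - x i) p ≤ η) ∧ (∀ j : Fin N, ‖x j - x i‖ ≤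 R → ∃ p ∈ S, dist (x j - x i) p ≤ η)} : ℝ) ≤ ∑ i, ((1 / 24 : ℝ) * siteEnergy (fun r => (r⁻¹) ^ 12) x i - (1 / 12 : ℝ) * τ ((Finset.univ.filter fun j : Fin N => dist (x j) (x i) ≤ R₁).image fun j => x j - x i)) - (N : ℝ) * ⨅ Q : PeriodicConfiguration 3, Q.energyPerParticle lennardJones)) → Summit.AtomisticToContinuum.Crystallization.Theses.FluxTubeKepler.FluxCellKepler := by
  intro h₁ h₂
  dsimp only at h₁ h₂
  obtain ⟨R₁, τ, hreal, hkep⟩ := h₂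
  -- (DOM) from sitewise realisation + flux-tube domination, by summation
  have hdom : ∀ (N : ℕ) (x : Fin N → EuclideanSpace ℝ (Fin 3)), Function.Injective x →
      ∑ i, siteEnergy (fun r => (r⁻¹) ^ 6) x i
        ≤ ∑ i, τ ((Finset.univ.filter fun j : Fin N => dist (x j) (x i) ≤ R₁).image fun j => x j - x i) := by
    intro N x hx
    obtain ⟨a, ha, hsep, Ω, G, hdisj, hmeas, hG, hvan, hdiv, hcell⟩ := hreal N x hx
    have h := h₁ a ha N x hsep Ω G hdisj hmeas hG hvan hdiv
    refine h.trans ?_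
    rw [Finset.mul_sum]
    exact Finset.sum_le_sum fun i _ => hcell i
  -- the τ-free defect pricing from DOM + KEPLER⋆ + the energy identity
  have hprice : ∀ δ : ℝ, 0 < δ → ∀ R η : ℝ, 0 < R → 0 < η → ∃ c : ℝ, 0 < c ∧ ∀ (N : ℕ) (x : Fin N → EuclideanSpace ℝ (Fin 3)), Function.Injective x → (∀ i j, i ≠ j → δ ≤ dist (x i) (x j)) → c * (Nat.card {i : Fin N // ¬ ∃ a : ℝ, 47 / 50 ≤ a ∧ a ≤ 1 ∧ ∃ (A : EuclideanSpace ℝ (Fin 3) →ₗᵢ[ℝ] EuclideanSpace ℝ (Fin 3)) (s : ℤ → ℤ) (z : ℤ → ℝ), IsHaggSeq s ∧ (∀ m : ℤ, 39 / 50 * a ≤ z (m + 1) - z m ∧ z (m + 1) - z m ≤ 17 / 20 * a) ∧ let S : Set (EuclideanSpace ℝ (Fin 3)) := {p | ∃ m k l : ℤ, p = A (((k : ℝ) • triangularVec₁ a) + ((l : ℝ) • triangularVec₂ a) + ((haggLabel s m : ℝ) • barlowOffset a) + (z m • layerNormal 1))}; (∀ p ∈ S, ‖p‖ ≤ R → ∃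 j : Fin N, dist (x j - x i) p ≤ η) ∧ (∀ j : Fin N, ‖x j - x i‖ ≤ R → ∃ p ∈ S, dist (x j - x i) p ≤ η)} : ℝ) ≤ interactionEnergy lennardJones x - (N : ℝ) * ⨅ Q : PeriodicConfiguration 3, Q.energyPerParticle lennardJones := by
    intro δ hδ R η hR hη
    obtain ⟨c, hc, hcb⟩ := hkep δ hδ R η hR hη
    refine ⟨c, hc, fun N x hx hsep => ?_⟩
    have hk := hcb N x hx hsep
    have hd := hdom N x hx
    have hE : interactionEnergy lennardJones x
        = ∑ i, ((1 / 24 : ℝ) * siteEnergy (fun r => (r⁻¹) ^ 12) x i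
            - (1 / 12 : ℝ) * siteEnergy (fun r => (r⁻¹) ^ 6) x i) :=
      Summit.AtomisticToContinuum.Crystallization.Theorems.FluxCellKeplerSketch.interactionEnergy_lennardJones_eq_sum x
    have hcmp : ∑ i, ((1 / 24 : ℝ) * siteEnergy (fun r => (r⁻¹) ^ 12) x i
          - (1 / 12 : ℝ) * τ ((Finset.univ.filter fun j : Fin N => dist (x j) (x i) ≤ R₁).image fun j => x j - x i))
        ≤ interactionEnergy lennardJones x := by
      rw [hE, Finset.sum_sub_distrib, Finset.sum_sub_distrib, ← Finset.mul_sum, ← Finset.mul_sum,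
        ← Finset.mul_sum]
      linarith
    linarith
  -- a periodic minimiser `P₀` (landed chain: pricing ⇒ layered windows ⇒ item 0627), `e(P₀) = e⋆`
  obtain ⟨P₀, hP₀⟩ :=
    Summit.AtomisticToContinuum.Crystallization.Theorems.FluxCellKeplerSketch.crysPeriodicMinAttained_of_defectPricing
      hprice
  have he : (⨅ Q : PeriodicConfiguration 3, Q.energyPerParticle lennardJones)
      = P₀.energyPerParticle lennardJones := by
    rw [← sInf_range]
    exact hP₀.csInf_eq
  refine ⟨P₀, R₁, τ, hdom, ?_⟩
  intro δ hδ R η hR hη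
  obtain ⟨c, hc, hcb⟩ := hkep δ hδ R η hR hη
  refine ⟨c, hc, fun N x hx hsep => ?_⟩
  have hk := hcb N x hx hsep
  rw [he] at hk
  exact hk


end Summit.AtomisticToContinuum.Crystallization.Theorems.FluxCellKeplerSplit
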